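import Summits.RiemannHypothesis.RiemannHypothesis.Theorems.HandoffCapacity
import Summits.RiemannHypothesis.RiemannHypothesis.Theorems.HandoffMarginLaw
import Summits.RiemannHypothesis.RiemannHypothesis.Theorems.SoloInformedNonDegenerate
import Summits.RiemannHypothesis.RiemannHypothesis.Theorems.SemilocalSoninPrimeWindow
import HarnessLib

/-!
# HANDOFF — the capacity of a place, part 2: monotonicity, silence below the entry, and the MARGIN LAW as a uniform capacity bound (cell rh-explicit, TRACK «HANDOFF», seat theory-2 gen5, file XII-i)

HONEST FRAMING. Nothing here bears on the truth of RH. Continuation of `HandoffCapacity.lean` (file XII-h: the semi-local wall of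
`S` is the unit level set of `ρ(S, p; b) = bsCapacity S p P b = sup placeGain p g / Re Q_{S ∪ {p}}(g)`). This file records the shape
of the crossing and places the track's typed structure slot E-1 (`HandoffMarginLaw.HandoffMargin m`: `(log q)/2 + m(q) ≤ a*(S_q)` for
every prime `q`; conj-1's MARGIN-LAW supplies `m`) in capacity language — the «one displayed formula» PROVABLE-NOW T1.1 asks for:

* §1 `bsCapacity_mono`: `b ≤ b′ ⟹ ρ(b) ≤ ρ(b′)` (larger window, larger sup; needs the positivity input at `b′`);
  `bsCapacity_eq_zero_of_le`: `ρ(S, p; b) = 0` for `b ≤ (log p)/2` (the place is silent below its entry, `placeGain_eq_zero_of_le`).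
  So on the handoff window `ρ_q` rises from `0` at `(log q)/2`, is non-decreasing, and (XII-h) the wall `a*(S_q)` is where it passes `1`.
* §2 the wall OFFSET as the crossing: for consecutive primes `q < q′`, `0 < b ≤ (log q′)/2`, `0 < ε(b)`:
  `b − (log q)/2 ≤ δ*(q) ↔ ρ_q(b) ≤ 1` and `δ*(q) < b − (log q)/2 ↔ 1 < ρ_q(b)`; under RH the input `0 < ε(b)` is automatic
  (`weilGroundEnergy_pos_of_riemannHypothesis`, Solo T62), so **under RH `δ*(q) = sup {δ ∈ window : ρ_q((log q)/2 + δ) ≤ 1}`** in the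
  exact sense of these two equivalences; and the GAIN obeys `ε(b) + D_q(b) ≤ ρ_q(b)·ε(b)` while `ρ_q(b) ≤ 1`.
* §3 **`handoffMargin_iff_forall_bsCapacity_le_one`**: for a margin function `m` living inside the windows
  (`0 < (log q)/2 + m(q) ≤ (log q⁺)/2`) and the positivity input at each `(log q)/2 + m(q)`,
  **`MARGIN(m) ↔ ∀ q prime, ρ_q((log q)/2 + m(q)) ≤ 1`**, i.e. `m(q) ≤ δ*(q)` for all `q` ⟺ NO test function on `C((log q)/2 + m(q))`
  draws more than its whole Weil energy from the place `q`, for any `q`; `…_of_riemannHypothesis`: the same with the input discharged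
  by RH (MARGIN(m) with m ≥ 0 implies RH anyway, `riemannHypothesis_of_handoffMargin`, so as a STRUCTURE statement the law is
  exactly this uniform capacity bound). What is NOT typed: any formula for `m` (conj-1's `P_∞/(w_q q(q−1))` and its rivals are MODEL).

References: as XII-h — Bombieri 2000 §4 [`Bombieri2000Weil`]; Connes–Consani 2023 §2.2–2.4 [`ConnesConsani2023`]; Yoshida 1992 Prop. 6,
Thm. 2 (non-degeneracy under RH) [`Yoshida1992HermitianForms`]; the capacity object is this cell's (weil-9 T17 §21), not in print.
-/

set_option linter.dupNamespace false  -- the mandated namespace repeats `RiemannHypothesis`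

noncomputable section
open Set Complex MeasureTheory Literature.NumberTheory.LFunctions
open Summit.RiemannHypothesis.RiemannHypothesis.Theorems.Handoff
open Summit.RiemannHypothesis.RiemannHypothesis.Theorems.HandoffAnalytic
open Summit.RiemannHypothesis.RiemannHypothesis.Theorems.HandoffSemilocalEnergy
open Summit.RiemannHypothesis.RiemannHypothesis.Theorems.HandoffMarginLaw
open Summit.RiemannHypothesis.RiemannHypothesis.Theorems.HandoffCapacity
open Summit.RiemannHypothesis.RiemannHypothesis.Theorems.HandoffDecomposition (nextPrime consecutivePrimes_nextPrime)
open Summit.RiemannHypothesis.RiemannHypothesis.Theorems.MotivicDoor.SemilocalThreshold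
open Summit.RiemannHypothesis.RiemannHypothesis.Theorems.MotivicDoor.Semilocal
open scoped Real ComplexConjugate ArithmeticFunction.vonMangoldt

namespace Summit.RiemannHypothesis.RiemannHypothesis.Theorems.HandoffCapacityMargin

variable {g : ℝ → ℂ} {S : Finset ℕ} {P : (ℝ → ℂ) → Prop} {b b' : ℝ} {p q q' : ℕ} {m : ℕ → ℝ}

/-! ## §1 Monotonicity in the window; silence below the entry -/

/-- The ratio sets grow with the window (the same test function qualifies on the larger window). [folklore] -/
theorem capacitySet_mono (hbb' : b ≤ b') : capacitySet S p P b ⊆ capacitySet S p P b' := by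
  rintro r ⟨g, hg, hs, hP, hn, rfl⟩
  exact ⟨g, hg, hs.trans (Icc_subset_Icc (neg_le_neg hbb') hbb'), hP, hn, rfl⟩

/-- **The capacity is non-decreasing in the window**: `b ≤ b′`, `0 < λ_min(S ∪ {p}; b′; P)` (the input at the LARGER window) and a
nonempty sphere at `b` give `ρ(S, p; b; P) ≤ ρ(S, p; b′; P)`. [folklore] -/
theorem bsCapacity_mono (hbb' : b ≤ b') (hpos' : 0 < semilocalGroundEnergy (insert p S) P b')
    (hne : (semilocalSphereValues S P b).Nonempty) : bsCapacity S p P b ≤ bsCapacity S p P b' :=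
  csSup_le_csSup (capacitySet_bddAbove hpos') (capacitySet_nonempty_iff.2 hne) (capacitySet_mono hbb')

/-- Below its entry the place is silent: `placeGain p g = 0` for `g ∈ C(b)`, `b ≤ (log p)/2`. [cite: Yoshida1992HermitianForms, §2 eq. (2.1) (only p^m ≤ e^{2a} enter)] -/
theorem placeGain_eq_zero_of_le (hp : p.Prime) (hb : b ≤ Real.log p / 2) (hg : IsWeilTest g)
    (hs : tsupport g ⊆ Icc (-b) b) : placeGain p g = 0 := by
  haveI : Fact p.Prime := ⟨hp⟩
  rw [placeGain, weilSemilocalPrimeTerm_singleton_weilConv_eq_zero_of_le hb hg hs, Complex.zero_re, neg_zero]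

/-- Hence the ratio set below the entry is `{0}` (nonempty sphere). [folklore] -/
theorem capacitySet_eq_singleton_zero_of_le (hp : p.Prime) (hb : b ≤ Real.log p / 2)
    (hne : (semilocalSphereValues S P b).Nonempty) : capacitySet S p P b = {0} := by
  ext r
  constructor
  · rintro ⟨g, hg, hs, -, -, rfl⟩
    rw [placeGain_eq_zero_of_le hp hb hg hs, zero_div, Set.mem_singleton_iff]
  · intro hr
    rw [Set.mem_singleton_iff] at hr
    subst hr
    obtain ⟨x, g, hg, hs, hP, hn, -⟩ := hne
    exact ⟨g, hg, hs, hP, hn, by rw [placeGain_eq_zero_of_le hp hb hg hs, zero_div]⟩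

/-- **`ρ(S, p; b; P) = 0` for `b ≤ (log p)/2`**: the capacity starts from zero at the entry of the place. [folklore] -/
theorem bsCapacity_eq_zero_of_le (hp : p.Prime) (hb : b ≤ Real.log p / 2)
    (hne : (semilocalSphereValues S P b).Nonempty) : bsCapacity S p P b = 0 := by
  rw [bsCapacity, capacitySet_eq_singleton_zero_of_le hp hb hne, csSup_singleton]

/-- On the handoff window of consecutive primes `q < q′` the all-sector capacity of `q` is non-decreasing:
`(log q)/2 ≤ b ≤ b′ ≤ (log q′)/2`, `0 < b`, `0 < ε(b′)` ⟹ `ρ_q(b) ≤ ρ_q(b′)`. [folklore] -/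
theorem bsCapacity_window_mono (h : ConsecutivePrimes q q') (hb0 : 0 < b) (hbb' : b ≤ b') (hb' : b' ≤ Real.log q' / 2)
    (hε : 0 < weilGroundEnergy b') :
    bsCapacity (Nat.primesBelow q) q (fun _ ↦ True) b ≤ bsCapacity (Nat.primesBelow q) q (fun _ ↦ True) b' := by
  refine bsCapacity_mono hbb' ?_ (semilocalSphereValues_top_nonempty _ hb0)
  rwa [semilocalGroundEnergy_insert_window h hb']

/-! ## §2 The wall OFFSET as the capacity crossing -/

/-- **`b − (log q)/2 ≤ δ*(q) ↔ ρ_q(b) ≤ 1`** on `0 < b ≤ (log q′)/2` with the input `0 < ε(b)` (`δ* = wallOffset`). [folklore] -/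
theorem sub_le_wallOffset_iff_bsCapacity_le_one (h : ConsecutivePrimes q q') (hb0 : 0 < b)
    (hb : b ≤ Real.log q' / 2) (hε : 0 < weilGroundEnergy b) :
    b - Real.log q / 2 ≤ wallOffset q ↔ bsCapacity (Nat.primesBelow q) q (fun _ ↦ True) b ≤ 1 := by
  rw [wallOffset, sub_le_sub_iff_right, le_wall_iff_bsCapacity_le_one h hb0 hb hε]

/-- **`δ*(q) < b − (log q)/2 ↔ 1 < ρ_q(b)`** (same hypotheses). [folklore] -/
theorem wallOffset_lt_sub_iff_one_lt_bsCapacity (h : ConsecutivePrimes q q') (hb0 : 0 < b)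
    (hb : b ≤ Real.log q' / 2) (hε : 0 < weilGroundEnergy b) :
    wallOffset q < b - Real.log q / 2 ↔ 1 < bsCapacity (Nat.primesBelow q) q (fun _ ↦ True) b := by
  rw [← not_le, sub_le_wallOffset_iff_bsCapacity_le_one h hb0 hb hε, not_le]

/-- **Under RH the input is automatic**: `b − (log q)/2 ≤ δ*(q) ↔ ρ_q(b) ≤ 1` for every `0 < b ≤ (log q′)/2` — the wall offset IS the
capacity crossing in the window, prime by prime (Solo T62 `weilGroundEnergy_pos_of_riemannHypothesis`). [cite: Yoshida1992HermitianForms, Thm. 2 (non-degeneracy under RH); this track] -/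
theorem sub_le_wallOffset_iff_of_riemannHypothesis (hRH : Summit.RiemannHypothesis) (h : ConsecutivePrimes q q')
    (hb0 : 0 < b) (hb : b ≤ Real.log q' / 2) :
    b - Real.log q / 2 ≤ wallOffset q ↔ bsCapacity (Nat.primesBelow q) q (fun _ ↦ True) b ≤ 1 :=
  sub_le_wallOffset_iff_bsCapacity_le_one h hb0 hb
    (weilGroundEnergy_pos_of_riemannHypothesis (Summit.RiemannHypothesis_iff.1 hRH) hb0)

/-- **The gain is at most capacity × ground energy** while `ρ_q(b) ≤ 1`: `ε(b) + D_q(b) ≤ ρ_q(b)·ε(b)` on `0 < b ≤ (log q′)/2`, `0 < ε(b)`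
(the left side is the GAIN `G_q(b) = λ_min(S_{q′}; b) − λ_min(S_q; b)` of HANDOFF-STATEMENT §H.3). [folklore] -/
theorem gain_le_bsCapacity_mul (h : ConsecutivePrimes q q') (hb0 : 0 < b) (hb : b ≤ Real.log q' / 2)
    (hε : 0 < weilGroundEnergy b) (hρ : bsCapacity (Nat.primesBelow q) q (fun _ ↦ True) b ≤ 1) :
    weilGroundEnergy b + aggregateDeficit q b ≤ bsCapacity (Nat.primesBelow q) q (fun _ ↦ True) b * weilGroundEnergy b := by
  have := aggregateDeficit_le_of_bsCapacity_le_one h hb0 hb hε hρ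
  linarith

/-! ## §3 The MARGIN LAW as a uniform capacity bound -/

/-- **`MARGIN(m) ↔ ∀ q prime, ρ_q((log q)/2 + m(q)) ≤ 1`** for a margin function living inside the windows
(`0 < (log q)/2 + m(q) ≤ (log q⁺)/2`) and the positivity input `0 < ε((log q)/2 + m(q))` at every prime: the wall-offset law
`m(q) ≤ δ*(q)` (slot E-1, `HandoffMargin`) says that on `C((log q)/2 + m(q))` no test function draws more than its whole Weil energy
from the place `q` — for every `q`. [this track (HANDOFF-STATEMENT §E-1; MARGIN-LAW); criterion folklore] -/
theorem handoffMargin_iff_forall_bsCapacity_le_one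
    (hm : ∀ q : ℕ, q.Prime → 0 < Real.log q / 2 + m q ∧ Real.log q / 2 + m q ≤ Real.log (nextPrime q) / 2)
    (hε : ∀ q : ℕ, q.Prime → 0 < weilGroundEnergy (Real.log q / 2 + m q)) :
    HandoffMargin m ↔
      ∀ q : ℕ, q.Prime → bsCapacity (Nat.primesBelow q) q (fun _ ↦ True) (Real.log q / 2 + m q) ≤ 1 := by
  rw [handoffMargin_iff_forall_le_wallOffset]
  refine forall₂_congr fun q hq ↦ ?_
  have key := sub_le_wallOffset_iff_bsCapacity_le_one (b := Real.log q / 2 + m q)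
    (consecutivePrimes_nextPrime hq) (hm q hq).1 (hm q hq).2 (hε q hq)
  rwa [add_sub_cancel_left] at key

/-- **Under RH**: `MARGIN(m) ↔ ∀ q prime, ρ_q((log q)/2 + m(q)) ≤ 1` for every margin function inside the windows — with `m ≥ 0`
MARGIN(m) implies RH (`riemannHypothesis_of_handoffMargin`), so as a statement of STRUCTURE beyond RH the law is exactly this uniform
capacity bound. [this track; Solo T62 for the input] -/
theorem handoffMargin_iff_forall_bsCapacity_le_one_of_riemannHypothesis (hRH : Summit.RiemannHypothesis)
    (hm : ∀ q : ℕ, q.Prime → 0 < Real.log q / 2 + m q ∧ Real.log q / 2 + m q ≤ Real.log (nextPrime q) / 2) :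
    HandoffMargin m ↔
      ∀ q : ℕ, q.Prime → bsCapacity (Nat.primesBelow q) q (fun _ ↦ True) (Real.log q / 2 + m q) ≤ 1 :=
  handoffMargin_iff_forall_bsCapacity_le_one hm fun q hq ↦
    weilGroundEnergy_pos_of_riemannHypothesis (Summit.RiemannHypothesis_iff.1 hRH) (hm q hq).1

end Summit.RiemannHypothesis.RiemannHypothesis.Theorems.HandoffCapacityMargin
end
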